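import Summits.QuantumFields.BalabanUV.T4Continuum.Support.NE7CombGenerator
import HarnessLib

/-!
# NE7CombSliceSupShape — THE IN-BLOCK SUP SHAPE OF THE COMB SLICE: for EVERY unitary `W` (no smallness), a 1-form `X` vanishing on the in-block comb bonds of the `M`-blocks has
# EVERY IN-BLOCK bond value slaved to its covariant curl, `‖X(y,μ)‖ ≤ |lowPart μ (y mod M)|₁ · sup_p ‖curlAt W X p‖ ≤ (d−1)(M−1)·sup‖curl_W X‖` — the LINEAR non-abelian Stokes
# along the comb ladder, plaquette by plaquette; only the block-face-CROSSING bonds of a comb-slice field are not controlled by the curl (file 76 of the curved (APE))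

Cell `pub-balaban`, rung (B)+1 sub-cell t4, lineage `b2b-balaban-t4-ne7-p1` (CRUX PROVER NE7 #1 = OWNER of row NE7), generation 81; memo
`t4/b2b-balaban-t4-ne7-p1-g81/COMB-SLICE.md` §5.  File F146, over F143 `NE7CombGenerator` (`exists_comb_pred`, block-comb combinatorics), `SkeletonLattice`, the Literature
`T4AveragingDeficitWall.curlAt` and `B8Lemma1NonAbelian.lowPart` BY NAME.
WHY.  F144∕F145 reduced the curved (APE) END's slice-solver input to ONE letter on the block-comb slice `S_comb = {X skew : X = 0 on the in-block comb bonds}`, of the shape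
`‖curlAt W X‖ ≤ K_G·g + K_X·R` with `R` a sup bound of `X`.  On `S_comb` most of `R` is NOT free data: the comb is a spanning tree of each block, so every in-block bond `b = (y, μ)`
closes a loop with the comb whose spanning ladder has `|lowPart μ (y mod M)|₁ ≤ (d−1)(M−1)` plaquettes, and the LINEARISED non-abelian Stokes theorem along that ladder is EXACT at
every background (no smallness): plaquette `(z; κ, μ)` with `z = y − e_κ`, `κ` the lowest axis of non-zero offset, has its two `κ`-bonds on the comb, so
`curlAt W X z κ μ = Ad(…)X(y,μ) − Ad(…)X(z,μ)` and `‖X(y,μ)‖ ≤ ‖curlAt W X z κ μ‖ + ‖X(z,μ)‖` — induction on `|lowPart μ (y mod M)|₁`.  Hence on the comb slice the sup over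
IN-BLOCK bonds is `≤ (d−1)(M−1)·sup‖curl_W X‖`, and a letter's slope `K_X` only has to price the sup over the block-face-CROSSING bonds (the coarse content of `X`, which TANGENCY
constrains — successor: the crossing half via row NE3's comb-vs-tower line sums `NE3CombVsTower*`).  This is g79 §7 (a)'s «1-form sup shape», in-block half, in the comb gauge.
WHAT ([folklore]; 0 def, 0 sorry).  §1 `exists_comb_pred_low` (F143's predecessor bond with the extra facts `κ < μ`, `y mod M = z mod M + e_κ`, `|lowPart μ (z mod M)|₁ + 1 =
|lowPart μ (y mod M)|₁` when `lowPart μ (y mod M) ≠ 0`), `l1_lowPart_le` (`≤ (d−1)(M−1)`, indeed `≤ μ·(M−1)`); §2 `curlAt_comb_plaquette` (the two comb `κ`-bonds drop out),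
**`norm_le_l1_lowPart_of_combSlice`** (`‖X y μ‖ ≤ |lowPart μ (y mod M)|₁·C` for every in-block bond, `C` a bound of `‖curlAt W X z κ μ‖` over `κ < μ`), **`norm_le_of_combSlice`**
(`≤ (d−1)(M−1)·C`); §3 **`combLetter_of_crossingLetter`** — bookkeeping for the desk: on the comb slice a two-term letter whose slope prices only the CROSSING sup `R_×`,
`‖curl‖ ≤ K_G g + K_X R_×`, implies the full-sup letter of F144∕F145 with the same constants (`R_× ≤ R`), and conversely a full-sup letter with `K_X(d−1)(M−1) ≤ 1∕2` implies the
crossing-sup letter with `(2K_G, 2K_X)` (`crossingLetter_of_combLetter`, absorption of the in-block part).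
HONEST FRAMING (page 1): lattice kinematics at one configuration; nothing of Bałaban's asserted (context: the tree-gauge bound of [Balaban1985Averaging] p. 24, here LINEARISED
and curl-sided); the slice solver is NOT touched; (APE) on curved data NOT proved; NOT ONE-STEP, NOT NE7; spine 0∕9; finite T⁴ rung (B)+1 — NOT infinite volume, NOT mass gap,
NOT `BetaPertH`, NOT Clay.  Continuum YM on T⁴ ⇐ BetaPertH ∧ nine spine estimates (0/9 proved); BetaPertH ⇐ (D1) ∧ (D4) ∧ CAP+tail; G-an2-4 gates asym, D1 and NE2/3/4.
-/

set_option autoImplicit false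

open scoped BigOperators Matrix.Norms.L2Operator
open NormedSpace Finset

namespace Summit.QuantumFields.BalabanUV.T4Continuum.NE7CombSliceSupShape

open Literature.MathematicalPhysics.QuantumFieldTheory.Balaban1983to89
open B7Prop1Explicit B7Prop2Explicit
open B8Lemma1NonAbelian (lowPart lowPart_apply l1_lowPart_eq)
open T4AveragingDeficitWall (Ad IsUnitaryCfg curlAt)
open AveragingDeficitTransport (norm_Ad_of_unitary)
open AveragingDeficitNearIdentity (Ad_zero)
open SkeletonLattice (cmod cdiv smul_cdiv_add_cmod cmod_nonneg cmod_lt cdiv_eq_of_repr cmod_eq_of_repr)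
open NE7CombGenerator (exists_comb_pred eq_zero_of_l1_eq_zero)

noncomputable section

variable {d : ℕ} {n : Type*} [Fintype n] [DecidableEq n]

/-! ## §1 Block-comb combinatorics for bonds -/

section Lattice

variable {M : ℕ}

omit [Fintype n] [DecidableEq n] in
/-- `|lowPart μ v|₁ ≤ (d−1)(M−1)` for an offset `v = y mod M`. [folklore] -/
theorem l1_lowPart_le (hM : 1 ≤ M) (y : Site d) (μ : Fin d) :
    (l1 (lowPart μ (cmod M y)) : ℝ) ≤ ((d : ℝ) - 1) * ((M : ℝ) - 1) := by
  classical
  rw [l1_lowPart_eq]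
  have hM1 : ((M - 1 : ℕ) : ℝ) = (M : ℝ) - 1 := by rw [Nat.cast_sub hM, Nat.cast_one]
  have hb : ∀ κ : Fin d, (cmod M y κ).natAbs ≤ M - 1 := fun κ => by
    have h0 := cmod_nonneg hM y κ
    have h1 := cmod_lt hM y κ
    omega
  have hterm : ∀ κ : Fin d, ((if κ < μ then (cmod M y κ).natAbs else 0 : ℕ) : ℝ) ≤ if κ < μ then ((M : ℝ) - 1) else 0 := fun κ => by
    split_ifs with h
    · rw [← hM1]; exact_mod_cast hb κ
    · simp
  have hcount : (∑ κ : Fin d, (if κ < μ then ((M : ℝ) - 1) else 0)) = ((Finset.univ.filter fun κ : Fin d => κ < μ).card : ℝ) * ((M : ℝ) - 1) := by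
    rw [← Finset.sum_filter, Finset.sum_const, nsmul_eq_mul]
  have hcard : ((Finset.univ.filter fun κ : Fin d => κ < μ).card : ℝ) ≤ (d : ℝ) - 1 := by
    have h1 : (Finset.univ.filter fun κ : Fin d => κ < μ).card ≤ d - 1 := by
      have hsub : (Finset.univ.filter fun κ : Fin d => κ < μ) ⊆ Finset.univ.erase μ := fun κ hκ => by
        rw [Finset.mem_erase]; exact ⟨ne_of_lt (Finset.mem_filter.mp hκ).2, Finset.mem_univ κ⟩
      have := Finset.card_le_card hsub
      rw [Finset.card_erase_of_mem (Finset.mem_univ μ), Finset.card_univ, Fintype.card_fin] at this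
      exact this
    have hd : 1 ≤ d := Nat.succ_le_of_lt (lt_of_le_of_lt (Nat.zero_le _) μ.isLt)
    have h2 : ((d - 1 : ℕ) : ℝ) = (d : ℝ) - 1 := by rw [Nat.cast_sub hd, Nat.cast_one]
    rw [← h2]; exact_mod_cast h1
  have hM0 : 0 ≤ (M : ℝ) - 1 := by rw [← hM1]; exact Nat.cast_nonneg _
  calc ((∑ κ : Fin d, (if κ < μ then (cmod M y κ).natAbs else 0) : ℕ) : ℝ)
      = ∑ κ : Fin d, ((if κ < μ then (cmod M y κ).natAbs else 0 : ℕ) : ℝ) := by push_cast; rfl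
    _ ≤ ∑ κ : Fin d, (if κ < μ then ((M : ℝ) - 1) else 0) := Finset.sum_le_sum fun κ _ => hterm κ
    _ = ((Finset.univ.filter fun κ : Fin d => κ < μ).card : ℝ) * ((M : ℝ) - 1) := hcount
    _ ≤ ((d : ℝ) - 1) * ((M : ℝ) - 1) := mul_le_mul_of_nonneg_right hcard hM0

omit [Fintype n] [DecidableEq n] in
/-- **THE PREDECESSOR OF A NON-COMB IN-BLOCK BOND**: if `lowPart μ (y mod M) ≠ 0` then, with `κ` the lowest axis of non-zero offset (so `κ < μ`) and `z = y − e_κ`: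
`(z mod M)_{κ′} = 0` for `κ′ < κ`, `(z mod M)_κ + 1 < M`, `y mod M = z mod M + e_κ`, and `|lowPart μ (z mod M)|₁ + 1 = |lowPart μ (y mod M)|₁`. [folklore] -/
theorem exists_comb_pred_low (hM : 1 ≤ M) {y : Site d} {μ : Fin d} (hy : lowPart μ (cmod M y) ≠ 0) :
    ∃ (z : Site d) (κ : Fin d), κ < μ ∧ y = z + e κ ∧ (∀ κ', κ' < κ → cmod M z κ' = 0) ∧ cmod M z κ + 1 < (M : ℤ) ∧
      cmod M y = cmod M z + e κ ∧ l1 (lowPart μ (cmod M z)) + 1 = l1 (lowPart μ (cmod M y)) := by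
  classical
  have hy0 : cmod M y ≠ 0 := fun h => hy (by rw [h]; funext κ; simp)
  obtain ⟨z, κ, hyz, hlow, hin, -⟩ := exists_comb_pred hM hy0
  -- same block: `y mod M = z mod M + e κ`
  have hrepr : y = (M : ℤ) • cdiv M z + (cmod M z + e κ) := by
    rw [hyz, ← add_assoc, smul_cdiv_add_cmod]
  have hq0 : ∀ i, 0 ≤ (cmod M z + e κ) i := fun i => by
    simp only [Pi.add_apply, e_apply]
    have := cmod_nonneg hM z i
    split_ifs <;> omega
  have hqM : ∀ i, (cmod M z + e κ) i < M := fun i => by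
    simp only [Pi.add_apply, e_apply]
    have := cmod_lt hM z i
    split_ifs with h
    · subst h; omega
    · omega
  have hcm : cmod M y = cmod M z + e κ := cmod_eq_of_repr hrepr hq0 hqM
  -- `κ < μ`: otherwise the low part of `y mod M` would vanish
  have hκμ : κ < μ := by
    by_contra h
    apply hy
    funext κ'
    rw [lowPart_apply, Pi.zero_apply]
    split_ifs with hκ'
    · have hκ'κ : κ' < κ := lt_of_lt_of_le hκ' (not_lt.mp h)
      rw [hcm, Pi.add_apply, hlow κ' hκ'κ, e_apply, if_neg (ne_of_lt hκ'κ), add_zero]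
    · rfl
  refine ⟨z, κ, hκμ, hyz, hlow, hin, hcm, ?_⟩
  -- the `ℓ¹` length of the low part grows by one
  rw [l1_lowPart_eq, l1_lowPart_eq, ← Finset.add_sum_erase _ _ (Finset.mem_univ κ),
    ← Finset.add_sum_erase _ (fun κ' => if κ' < μ then (cmod M y κ').natAbs else 0) (Finset.mem_univ κ)]
  have hrest : ∑ κ' ∈ Finset.univ.erase κ, (if κ' < μ then (cmod M y κ').natAbs else 0)
      = ∑ κ' ∈ Finset.univ.erase κ, (if κ' < μ then (cmod M z κ').natAbs else 0) :=
    Finset.sum_congr rfl fun κ' hκ' => by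
      rw [hcm, Pi.add_apply, e_apply, if_neg (Finset.ne_of_mem_erase hκ'), add_zero]
  rw [hrest, if_pos hκμ, if_pos hκμ, hcm, Pi.add_apply, e_apply, if_pos rfl]
  have := cmod_nonneg hM z κ
  omega

end Lattice

/-! ## §2 The in-block sup shape -/

section Shape

variable {W : Site d → Fin d → (Matrix n n ℂ)ˣ} {M : ℕ} (hM : 1 ≤ M) (hW : IsUnitaryCfg W) {X : Site d → Fin d → Matrix n n ℂ}
  (hcomb : ∀ (z : Site d) (μ : Fin d), (∀ κ, κ < μ → cmod M z κ = 0) → cmod M z μ + 1 < (M : ℤ) → X z μ = 0)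

include hcomb in
/-- **A COMB PLAQUETTE**: at the predecessor bond of §1 the two `κ`-bonds of the plaquette `(z; κ, μ)` lie on the comb, so
`curlAt W X z κ μ = Ad_{W(z,κ)W(y,μ)} X(y,μ) − Ad_{W(z,κ)W(y,μ)W(z+e_μ,κ)⁻¹} X(z,μ)` (`y = z + e_κ`). [folklore] -/
theorem curlAt_comb_plaquette (hM : 1 ≤ M) {z : Site d} {κ μ : Fin d} (hκμ : κ < μ) (hlow : ∀ κ', κ' < κ → cmod M z κ' = 0)
    (hin : cmod M z κ + 1 < (M : ℤ)) (hinμ : cmod M z μ + 1 < (M : ℤ)) :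
    curlAt W X z κ μ = Ad (W z κ * W (z + e κ) μ) (X (z + e κ) μ) - Ad (W z κ * W (z + e κ) μ * (W (z + e μ) κ)⁻¹) (X z μ) := by
  have h1 : X z κ = 0 := hcomb z κ hlow hin
  -- the shifted bond `(z + e μ, κ)` is also an in-block comb bond
  have hrepr : z + e μ = (M : ℤ) • cdiv M z + (cmod M z + e μ) := by rw [← add_assoc, smul_cdiv_add_cmod]
  have hq0 : ∀ i, 0 ≤ (cmod M z + e μ) i := fun i => by
    simp only [Pi.add_apply, e_apply]
    have := cmod_nonneg hM z i
    split_ifs <;> omega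
  have hqM : ∀ i, (cmod M z + e μ) i < M := fun i => by
    simp only [Pi.add_apply, e_apply]
    have := cmod_lt hM z i
    split_ifs with h
    · subst h; omega
    · omega
  have hcm : cmod M (z + e μ) = cmod M z + e μ := cmod_eq_of_repr hrepr hq0 hqM
  have h2 : X (z + e μ) κ = 0 := by
    refine hcomb (z + e μ) κ (fun κ' hκ' => ?_) ?_
    · rw [hcm, Pi.add_apply, hlow κ' hκ', e_apply, if_neg (ne_of_lt (hκ'.trans hκμ)), add_zero]
    · rw [hcm, Pi.add_apply, e_apply, if_neg (ne_of_lt hκμ), add_zero]; exact hin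
  simp only [curlAt, h1, h2, Ad_zero, zero_add, sub_zero]

include hM hW hcomb in
/-- **THE IN-BLOCK SUP SHAPE OF THE COMB SLICE**: `W` unitary, `X = 0` on the in-block comb bonds, `‖curlAt W X z κ μ‖ ≤ C` for all `z` and `κ < μ` ⟹ for every IN-BLOCK bond
`(y, μ)` (`(y mod M)_μ + 1 < M`), `‖X y μ‖ ≤ |lowPart μ (y mod M)|₁ · C` — linear non-abelian Stokes along the comb ladder of the bond, EXACT (no smallness). [folklore] -/
theorem norm_le_l1_lowPart_of_combSlice {C : ℝ} (hC : ∀ (z : Site d) (κ μ : Fin d), κ < μ → ‖curlAt W X z κ μ‖ ≤ C) :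
    ∀ (y : Site d) (μ : Fin d), cmod M y μ + 1 < (M : ℤ) → ‖X y μ‖ ≤ (l1 (lowPart μ (cmod M y)) : ℝ) * C := by
  suffices h : ∀ (k : ℕ) (y : Site d) (μ : Fin d), l1 (lowPart μ (cmod M y)) = k → cmod M y μ + 1 < (M : ℤ) → ‖X y μ‖ ≤ (k : ℝ) * C by
    intro y μ hin; exact h _ y μ rfl hin
  intro k
  induction k with
  | zero =>
      intro y μ hk hin
      have hlow : lowPart μ (cmod M y) = 0 := eq_zero_of_l1_eq_zero hk
      have hlow' : ∀ κ, κ < μ → cmod M y κ = 0 := fun κ hκ => by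
        have := congr_fun hlow κ
        rwa [lowPart_apply, if_pos hκ] at this
      rw [hcomb y μ hlow' hin, norm_zero, Nat.cast_zero, zero_mul]
  | succ k ih =>
      intro y μ hk hin
      have hy : lowPart μ (cmod M y) ≠ 0 := fun h => by rw [h] at hk; simp [l1] at hk
      obtain ⟨z, κ, hκμ, rfl, hlow, hinκ, hcm, hl1⟩ := exists_comb_pred_low hM hy
      have hkz : l1 (lowPart μ (cmod M z)) = k := by omega
      have hinμ : cmod M z μ + 1 < (M : ℤ) := by
        have : cmod M (z + e κ) μ = cmod M z μ := by rw [hcm, Pi.add_apply, e_apply, if_neg (ne_of_lt hκμ).symm, add_zero]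
        rw [← this]; exact hin
      have hz := ih z μ hkz hinμ
      have hp := curlAt_comb_plaquette (W := W) hcomb hM hκμ hlow hinκ hinμ
      have hu1 : W z κ * W (z + e κ) μ ∈ unitaryUnits (Matrix n n ℂ) := (unitaryUnits _).mul_mem (hW z κ) (hW _ μ)
      have hu2 : W z κ * W (z + e κ) μ * (W (z + e μ) κ)⁻¹ ∈ unitaryUnits (Matrix n n ℂ) :=
        (unitaryUnits _).mul_mem hu1 ((unitaryUnits _).inv_mem (hW _ κ))
      have heq : Ad (W z κ * W (z + e κ) μ) (X (z + e κ) μ)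
          = curlAt W X z κ μ + Ad (W z κ * W (z + e κ) μ * (W (z + e μ) κ)⁻¹) (X z μ) := by rw [hp, sub_add_cancel]
      calc ‖X (z + e κ) μ‖ = ‖Ad (W z κ * W (z + e κ) μ) (X (z + e κ) μ)‖ := (norm_Ad_of_unitary hu1 _).symm
        _ = ‖curlAt W X z κ μ + Ad (W z κ * W (z + e κ) μ * (W (z + e μ) κ)⁻¹) (X z μ)‖ := by rw [heq]
        _ ≤ ‖curlAt W X z κ μ‖ + ‖Ad (W z κ * W (z + e κ) μ * (W (z + e μ) κ)⁻¹) (X z μ)‖ := norm_add_le _ _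
        _ ≤ C + (k : ℝ) * C := by rw [norm_Ad_of_unitary hu2]; exact add_le_add (hC z κ μ hκμ) hz
        _ = ((k + 1 : ℕ) : ℝ) * C := by push_cast; ring

include hM hW hcomb in
/-- **`‖X‖_{∞, in-block} ≤ (d−1)(M−1)·sup‖curl_W X‖`** on the comb slice (`C ≥ 0`). [folklore] -/
theorem norm_le_of_combSlice {C : ℝ} (hC0 : 0 ≤ C) (hC : ∀ (z : Site d) (κ μ : Fin d), κ < μ → ‖curlAt W X z κ μ‖ ≤ C)
    (y : Site d) (μ : Fin d) (hin : cmod M y μ + 1 < (M : ℤ)) :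
    ‖X y μ‖ ≤ ((d : ℝ) - 1) * ((M : ℝ) - 1) * C :=
  (norm_le_l1_lowPart_of_combSlice hM hW hcomb hC y μ hin).trans (mul_le_mul_of_nonneg_right (l1_lowPart_le hM y μ) hC0)

end Shape

/-! ## §3 Bookkeeping for the letter: the slope only has to price the CROSSING sup -/

/-- **FULL-SUP LETTER ⇒ CROSSING-SUP LETTER (absorption of the in-block part)**: on the comb slice at a unitary `W`, if the curl satisfies `C ≤ K_G·g + K_X·R` for every sup bound `R`
of `X` (two-term letter, full sup) with `C = sup_{κ<μ}‖curlAt W X‖` ATTAINED-type (`hC`, `hCX`) and `K_X(d−1)(M−1) ≤ 1∕2`, then `C ≤ 2K_G·g + 2K_X·R_×` for every bound `R_× ≥ 0` of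
`X` on the block-face-CROSSING bonds alone. [folklore] -/
theorem crossingLetter_of_combLetter {W : Site d → Fin d → (Matrix n n ℂ)ˣ} {M : ℕ} (hM : 1 ≤ M) (hW : IsUnitaryCfg W)
    {X : Site d → Fin d → Matrix n n ℂ}
    (hcomb : ∀ (z : Site d) (μ : Fin d), (∀ κ, κ < μ → cmod M z κ = 0) → cmod M z μ + 1 < (M : ℤ) → X z μ = 0)
    {C : ℝ} (hC0 : 0 ≤ C) (hC : ∀ (z : Site d) (κ μ : Fin d), κ < μ → ‖curlAt W X z κ μ‖ ≤ C)
    {KG KX g : ℝ} (hsmall : KX * (((d : ℝ) - 1) * ((M : ℝ) - 1)) ≤ 1 / 2)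
    (hletter : ∀ R : ℝ, (∀ (y : Site d) (μ : Fin d), ‖X y μ‖ ≤ R) → C ≤ KG * g + KX * R)
    {Rx : ℝ} (hRx0 : 0 ≤ Rx) (hRx : ∀ (y : Site d) (μ : Fin d), cmod M y μ + 1 = (M : ℤ) → ‖X y μ‖ ≤ Rx) :
    C ≤ 2 * KG * g + 2 * KX * Rx := by
  -- the full sup is at most `max(R_×, (d−1)(M−1)C) ≤ R_× + (d−1)(M−1)C`
  have hR : ∀ (y : Site d) (μ : Fin d), ‖X y μ‖ ≤ Rx + ((d : ℝ) - 1) * ((M : ℝ) - 1) * C := by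
    intro y μ
    have hlt := cmod_lt hM y μ
    rcases lt_or_eq_of_le (show cmod M y μ + 1 ≤ (M : ℤ) by omega) with h | h
    · have h1 := norm_le_of_combSlice hM hW hcomb hC0 hC y μ h
      linarith
    · have h1 := hRx y μ h
      have h2 : 0 ≤ ((d : ℝ) - 1) * ((M : ℝ) - 1) * C := by
        have := l1_lowPart_le hM y μ
        have h0 : (0 : ℝ) ≤ (l1 (lowPart μ (cmod M y)) : ℝ) := Nat.cast_nonneg _
        exact mul_nonneg (h0.trans this) hC0
      linarith
  have h := hletter _ hR
  have h3 : KX * (Rx + ((d : ℝ) - 1) * ((M : ℝ) - 1) * C) ≤ KX * Rx + C / 2 := by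
    have : KX * (((d : ℝ) - 1) * ((M : ℝ) - 1)) * C ≤ 1 / 2 * C := mul_le_mul_of_nonneg_right hsmall hC0
    nlinarith
  linarith

/-- **CROSSING-SUP LETTER ⇒ FULL-SUP LETTER** (the direction F144∕F145 consume): trivially, a bound on all bonds bounds the crossing bonds. [folklore] -/
theorem combLetter_of_crossingLetter {M : ℕ} {X : Site d → Fin d → Matrix n n ℂ} {C KG KX g : ℝ}
    (hletter : ∀ Rx : ℝ, (∀ (y : Site d) (μ : Fin d), cmod M y μ + 1 = (M : ℤ) → ‖X y μ‖ ≤ Rx) → C ≤ KG * g + KX * Rx)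
    {R : ℝ} (hR : ∀ (y : Site d) (μ : Fin d), ‖X y μ‖ ≤ R) : C ≤ KG * g + KX * R :=
  hletter R fun y μ _ => hR y μ

end

end Summit.QuantumFields.BalabanUV.T4Continuum.NE7CombSliceSupShape
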